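import Literature.NumberTheory.Transcendental.ManyCurveThetaPure
import Literature.NumberTheory.Transcendental.ManyCurveThetaLineality
import Literature.NumberTheory.Transcendental.ManyCurveThetaSplit
import Literature.NumberTheory.Transcendental.ManyCurveKronecker
import Literature.NumberTheory.Transcendental.ThetaFibreCount
import HarnessLib

/-!
# The fibre count for the `k`-lattice theta model: the abelian projection of the lineality space is classwise saturated

Topic `Literature/NumberTheory/Transcendental`; unit
`provefact-Literature.NumberTheory.Transcendental.H-0a3eb64689` (fact
`Literature.NumberTheory.Transcendental.HuberWustholzManyCurvePeriods`, `ManyCurvePeriods.lean`).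
It introduces NO named fact. Lattice-family counterpart of the one-lattice `ThetaFibreCount.lean`
for the theta model of `ManyCurveTheta.lean` (lattice family `L : 𝓙 → PeriodPair` of PAIRWISE
NON-ISOGENOUS lattices, class map `cls : γ → 𝓙` whose CM classes carry one block). Let `H` be a
`Θ`-closed IRREDUCIBLE subgroup of `V = Lie M_κ,ℂ`, `𝔥 = 𝒯(H)`, `𝔷₀ = z'(𝔥)` and
`ratHullCls 𝔷₀ ⊇ 𝔷₀` the subspace cut out by the CLASSWISE rational relations of `𝔷₀`
(`KronFam.ratHullCls`; `zRelCls` below is the rational system they span, block-diagonal).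

* `thetaEval_products_independent` — the products of the pure forms (independent on
  `(0, ratHullCls 𝔷₀, 0)`) with the fibre monomials are linearly independent modulo `𝔍(H)`; the
  one-lattice proof verbatim with the Kronecker lemma of `ManyCurveKronecker.lean`
  (`KronFam.eq_zero_on_ratHullCls`: `Hom(E_i,E_j) = 0`, `End E_i = ℤ`, CM classes single) in
  place of `Kron.eq_zero_on_ratHull`;
* `finrank_ratHullCls_add_le_coneDim` — `dim ratHullCls 𝔷₀ + dim yDir + dim sDir + 1 ≤ coneDim H`;
* `ratHullCls_zProj_linSpace_eq` — hence `ratHullCls 𝔷₀ = 𝔷₀`: the abelian projection of the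
  lineality space is cut out by classwise rational equations.

Everything is PROVED; the only definition is `zRelCls`.

## References

* Yu. V. Nesterenko, P. Philippon (eds.), *Introduction to Algebraic Independence Theory*,
  LNM 1752, Springer 2001, Ch. 11 (D. Roy), Prop. 2.3, Thm. 4.1. [NesterenkoPhilippon2001]
* D. Bertrand, P. Philippon, *Sous-groupes algébriques de groupes algébriques commutatifs*,
  Illinois J. Math. 32 (1988), 263–280. [folklore]
* A. Huber, G. Wüstholz, *Transcendence and Linear Relations of 1-Periods*, Cambridge Tracts 227,
  CUP 2022, Thm. 15.3 (1). [HuberWustholz2022]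
-/

noncomputable section

open Complex MvPolynomial Module
open scoped PeriodPair

namespace Literature.NumberTheory.Transcendental

namespace GaGmEFam

namespace Std

open GaGmE (Kbar)
open GaGmE.Std (iy iz is coords coords_iy coords_iz coords_is yPart zPart sPart ThetaIdx thetaT thetaT_none
  thetaT_some κ₀ pureIdx zOnly pureData yDir sDir zProj zEmb mem_yDir_iff mem_sDir_iff eq_coords_add_of_z_eq_zero
  fibIdx fibVar fibJ₀ fibForm isHomogeneous_fibForm fibFun fibFun_linearIndependent degLE mem_degLE_iff card_degLE
  choose_add_le_choose_mul_choose sum_fin_add_choose)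

variable {𝓙 : Type} [DecidableEq 𝓙] {β γ δ : Type} [Fintype β] [Fintype γ] [Fintype δ] [DecidableEq γ]
variable (L : 𝓙 → PeriodPair) (cls : γ → 𝓙) (κM : δ → γ → Kbar)

/-! ### The classwise rational relations of a subspace -/

variable {L κM} in
/-- **The classwise rational relations** of `𝔷 ≤ ℂ^γ`: the rational system spanned by the
rational relations of `𝔷` supported in a single class. [folklore] -/
def zRelCls (𝔷 : Submodule ℂ (γ → ℂ)) : Submodule ℚ (γ → ℚ) :=
  Submodule.span ℚ {c | c ∈ Kron.zRel 𝔷 ∧ ∃ i : 𝓙, ∀ b, cls b ≠ i → c b = 0}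

omit [DecidableEq γ] [DecidableEq 𝓙] in
variable {L κM} in
/-- The solution space of the classwise rational relations is `ratHullCls`. [folklore] -/
theorem TZ_pureData_zRelCls (𝔷 : Submodule ℂ (γ → ℂ)) :
    (pureData (zRelCls cls 𝔷)).TZ = KronFam.ratHullCls cls 𝔷 := by
  ext z
  rw [GaGmE.Std.SubgroupDataC.mem_TZ_iff, KronFam.mem_ratHullCls_iff]
  change (∀ c ∈ zRelCls cls 𝔷, ∑ b, (c b : ℂ) * z b = 0) ↔ _
  constructor
  · intro h i c hc hci
    exact h c (Submodule.subset_span ⟨hc, i, hci⟩)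
  · intro h c hc
    induction hc using Submodule.span_induction with
    | mem c' hc' =>
      obtain ⟨hc', i, hci'⟩ := hc'
      exact h i c' hc' hci'
    | zero => simp
    | add c c' _ _ hc hc' =>
      simp only [Pi.add_apply, Rat.cast_add, add_mul, Finset.sum_add_distrib, hc, hc', add_zero]
    | smul a c _ hc =>
      simp only [Pi.smul_apply, smul_eq_mul, Rat.cast_mul, mul_assoc, ← Finset.mul_sum, hc, mul_zero]

omit [DecidableEq γ] in
variable {L κM} in
/-- The classwise rational relations are block-diagonal. [folklore] -/
theorem isBlockDiag_zRelCls (𝔷 : Submodule ℂ (γ → ℂ)) : IsBlockDiag cls (zRelCls cls 𝔷) := by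
  intro c hc j
  induction hc using Submodule.span_induction with
  | mem c hc =>
    obtain ⟨hc, i, hci⟩ := hc
    by_cases hij : j = i
    · subst hij
      have : restr cls j c = c := by
        funext b
        by_cases hb : cls b = j
        · rw [restr_apply_of_eq cls hb]
        · rw [restr_apply_of_ne cls hb, hci b hb]
      rw [this]
      exact Submodule.subset_span ⟨hc, j, hci⟩
    · have : restr cls j c = 0 := by
        funext b
        by_cases hb : cls b = j
        · rw [restr_apply_of_eq cls hb, Pi.zero_apply, hci b (hb ▸ hij)]
        · rw [restr_apply_of_ne cls hb, Pi.zero_apply]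
      rw [this]
      exact Submodule.zero_mem _
  | zero =>
    have : restr cls j (0 : γ → ℚ) = 0 := by funext b; by_cases hb : cls b = j <;> simp [restr, hb]
    rw [this]; exact Submodule.zero_mem _
  | add c c' _ _ hc hc' =>
    have : restr cls j (c + c') = restr cls j c + restr cls j c' := by
      funext b; by_cases hb : cls b = j <;> simp [restr, hb]
    rw [this]; exact Submodule.add_mem _ hc hc'
  | smul a c _ hc =>
    have : restr cls j (a • c) = a • restr cls j c := by
      funext b; by_cases hb : cls b = j <;> simp [restr, hb]
    rw [this]; exact Submodule.smul_mem _ a hc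

/-! ### Pure forms and the kernel -/

omit [DecidableEq 𝓙] in
/-- **Pure forms have `Λ^γ`-invariant zero sets on `(0, z, 0)`.** [folklore] -/
theorem thetaEval_pureRename_coords_add_latt {P : MvPolynomial (Option Empty × ThetaIdx γ Empty) ℂ} {d : ℕ}
    (hP : (rename (pureIdx (β := β) (δ := δ)) P).IsHomogeneous d) (z : γ → ℂ)
    (hz : thetaEval L cls κM (rename (pureIdx (β := β) (δ := δ)) P) (coords (0 : β → ℂ) z (0 : δ → ℂ)) = 0) (m n : γ → ℤ) :
    thetaEval L cls κM (rename (pureIdx (β := β) (δ := δ)) P) (coords (0 : β → ℂ) (z + KronFam.latt L cls m n) (0 : δ → ℂ)) = 0 := by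
  have hk := coords_lattice_mem_ker (β := β) L cls κM m n
  have h := (thetaEval_add_ker_eq_zero_iff L cls κM hP hk (coords (0 : β → ℂ) z (0 : δ → ℂ))).mpr hz
  rw [← h]
  refine thetaEval_pureRename_eq_of_zPart_eq L cls κM P ?_
  funext b
  simp [zPart, KronFam.latt]

omit [DecidableEq 𝓙] in
/-- Pure forms at `(0, z, 0)` are entire in `z`. [folklore] -/
theorem differentiable_thetaEval_coords (P : MvPolynomial (Option β × ThetaIdx γ δ) ℂ) :
    Differentiable ℂ fun z : γ → ℂ => thetaEval L cls κM P (coords (0 : β → ℂ) z (0 : δ → ℂ)) := by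
  have h1 : Differentiable ℂ (fun w : β ⊕ (γ ⊕ δ) → ℂ => thetaEval L cls κM P w) :=
    fun w => (analyticOnNhd_thetaEval L cls κM P w (Set.mem_univ w)).differentiableAt
  have h2 : Differentiable ℂ fun z : γ → ℂ => (coords (0 : β → ℂ) z (0 : δ → ℂ) : β ⊕ (γ ⊕ δ) → ℂ) := by
    have : (fun z : γ → ℂ => (coords (0 : β → ℂ) z (0 : δ → ℂ) : β ⊕ (γ ⊕ δ) → ℂ)) =
        fun z => (zEmb (β := β) (δ := δ)).toContinuousLinearMap z := by
      funext z; rfl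
    rw [this]
    exact (zEmb (β := β) (δ := δ)).toContinuousLinearMap.differentiable
  exact Differentiable.comp (g := fun w : β ⊕ (γ ⊕ δ) → ℂ => thetaEval L cls κM P w) h1 h2


/-! ### Independence of the products modulo `𝔍(H)` -/

section Model

variable {N : ℕ} (M : AnalyticGroupModel (β ⊕ (γ ⊕ δ) → ℂ) N) (e : Option β × ThetaIdx γ δ ≃ Fin (N + 1))
variable (hΘ : ∀ J w, M.Θ (e J) w = theta L cls κM J w)
include hΘ

omit [DecidableEq 𝓙] in
/-- **Division by a coordinate on an irreducible set**: if `Q · X_{J₀}` vanishes on the irreducible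
closed `H ∋ 0` and `Θ_{J₀}(0) ≠ 0`, then `Q` vanishes on `H`. [folklore] -/
theorem thetaEval_eq_zero_of_mul_X {H : AddSubgroup (β ⊕ (γ ⊕ δ) → ℂ)} (hH : M.IsIrred (H : Set (β ⊕ (γ ⊕ δ) → ℂ)))
    {Q : MvPolynomial (Option β × ThetaIdx γ δ) ℂ} {d : ℕ} (hQ : Q.IsHomogeneous d)
    (J₀ : Option β × ThetaIdx γ δ) (hJ₀ : theta L cls κM J₀ 0 ≠ 0)
    (h : ∀ x ∈ H, theta L cls κM J₀ x ≠ 0 → thetaEval L cls κM Q x = 0) : ∀ x ∈ H, thetaEval L cls κM Q x = 0 := by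
  have hhom : (rename e (Q * X J₀)).IsHomogeneous (d + 1) :=
    (hQ.mul (isHomogeneous_X ℂ J₀)).rename_isHomogeneous
  have hmem : rename e (Q * X J₀) ∈ M.vanishing (H : Set (β ⊕ (γ ⊕ δ) → ℂ)) := by
    rw [M.mem_vanishing_iff_of_isHomogeneous hhom]
    intro w hw
    rw [F_rename L cls κM M e hΘ]
    simp only [thetaEval, map_mul, eval_X]
    by_cases h0 : theta L cls κM J₀ w = 0
    · rw [h0, mul_zero]
    · have := h w hw h0
      rw [thetaEval] at this
      rw [this, zero_mul]
  rw [map_mul] at hmem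
  rcases hH.isPrime.mem_or_mem hmem with hQmem | hXmem
  · intro x hx
    have := (M.mem_vanishing_iff_of_isHomogeneous hQ.rename_isHomogeneous).mp hQmem x hx
    rwa [F_rename L cls κM M e hΘ] at this
  · exfalso
    have := (M.mem_vanishing_iff_of_isHomogeneous (isHomogeneous_X ℂ J₀).rename_isHomogeneous).mp hXmem 0 H.zero_mem
    rw [F_rename L cls κM M e hΘ] at this
    simp [thetaEval] at this
    exact hJ₀ this

omit [DecidableEq 𝓙] in
/-- **The products `Q_k · R_μ` are linearly independent modulo `𝔍(H)`** (module docstring): a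
relation `∑ a_{kμ} F_{Q_k} F_{R_μ} = 0` on `H` is trivial. Here `H` is a closed irreducible subgroup,
the `Q_k = ρ P_k` are pure forms of degree `d` independent on `(0, ratHull 𝔷₀, 0)`, the `R_μ` are
the fibre monomials of degree `d` for a chart `M₀` with `Θ₀(0) ≠ 0` and free coordinates of
`yDir 𝒯(H)`, `sDir 𝒯(H)`, and `Λ` has no complex multiplication. [folklore] -/
theorem thetaEval_products_independent (hiso : ∀ i j, i ≠ j → ¬ (L i).IsIsogenousTo (L j)) (hcm1 : ∀ b b', cls b = cls b' → (L (cls b)).HasCM → b = b') {H : AddSubgroup (β ⊕ (γ ⊕ δ) → ℂ)}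
    (hH : M.IsIrred (H : Set (β ⊕ (γ ⊕ δ) → ℂ))) (d : ℕ)
    {n : ℕ} (P : Fin n → MvPolynomial (Option Empty × ThetaIdx γ Empty) ℂ)
    (hPhom : ∀ k, (rename (pureIdx (β := β) (δ := δ)) (P k)).IsHomogeneous d)
    (hPli : LinearIndependent ℂ fun k => fun z : (pureData (zRelCls cls
        ((AnalyticGroupModel.linSpace (H : Set (β ⊕ (γ ⊕ δ) → ℂ))).map zProj))).TZ =>
      thetaEval L cls κM (rename (pureIdx (β := β) (δ := δ)) (P k)) (coords (0 : β → ℂ) (z : γ → ℂ) (0 : δ → ℂ)))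
    (M₀ : γ → Fin 3) (hM₀ : thetaPnone (β := β) (δ := δ) L cls M₀ 0 ≠ 0) (Fy : Finset β) (Fs : Finset δ)
    (hY : Function.Surjective fun y : yDir (AnalyticGroupModel.linSpace (H : Set (β ⊕ (γ ⊕ δ) → ℂ))) =>
      fun j : Fy => (y : β → ℂ) j)
    (hS : Function.Surjective fun s : sDir (AnalyticGroupModel.linSpace (H : Set (β ⊕ (γ ⊕ δ) → ℂ))) =>
      fun e' : Fs => (s : δ → ℂ) e')
    (T : Finset (fibIdx Fy Fs →₀ ℕ)) (hT : ∀ μ ∈ T, μ.degree ≤ d)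
    (a : Fin n → (fibIdx Fy Fs →₀ ℕ) → ℂ)
    (ha : ∀ w ∈ H, ∑ k, ∑ μ ∈ T, a k μ *
      (thetaEval L cls κM (rename (pureIdx (β := β) (δ := δ)) (P k)) w * thetaEval L cls κM (fibForm M₀ Fy Fs d μ) w) = 0) :
    ∀ k, ∀ μ ∈ T, a k μ = 0 := by
  classical
  set 𝔥 := AnalyticGroupModel.linSpace (H : Set (β ⊕ (γ ⊕ δ) → ℂ)) with h𝔥
  set 𝔷₀ := 𝔥.map zProj with h𝔷₀
  set Q : Fin n → MvPolynomial (Option β × ThetaIdx γ δ) ℂ := fun k => rename (pureIdx (β := β) (δ := δ)) (P k) with hQ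
  have hcl := hH.isClosedG
  -- Step A: on `H ∩ {Θ₀ ≠ 0}` every pure coefficient form vanishes
  have hA : ∀ x ∈ H, thetaPnone (β := β) (δ := δ) L cls M₀ x ≠ 0 → ∀ μ ∈ T, ∑ k, a k μ * thetaEval L cls κM (Q k) x = 0 := by
    intro x hx hx0 μ hμ
    set E : (fibIdx Fy Fs →₀ ℕ) → ℂ := fun μ' =>
      thetaPnone (β := β) (δ := δ) L cls M₀ x ^ d * ∏ j : Fy, cexp (x (iy j)) ^ μ' (Sum.inl j) with hE
    have hE0 : ∀ μ', E μ' ≠ 0 := fun μ' =>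
      mul_ne_zero (pow_ne_zero _ hx0) (Finset.prod_ne_zero_iff.mpr fun j _ => pow_ne_zero _ (exp_ne_zero _))
    have hc := fibFun_linearIndependent Fy Fs (yDir 𝔥) (sDir 𝔥) hY hS (fibNu L cls κM M₀ x) T
      (fun μ' => (∑ k, a k μ' * thetaEval L cls κM (Q k) x) * E μ') ?_ μ hμ
    · exact (mul_eq_zero.mp hc).resolve_right (hE0 μ)
    intro y hy s hs
    -- `x + (y, 0, s) ∈ H`
    have hu : coords y (0 : γ → ℂ) s ∈ 𝔥 := by
      refine (mem_linSpace_iff_of_z_eq_zero L cls κM M e hΘ hcl (r := coords y (0 : γ → ℂ) s) (fun b => by simp)).mpr ⟨?_, ?_⟩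
      · have : yPart (coords y (0 : γ → ℂ) s) = y := by funext j; simp [yPart]
        rw [this]; exact hy
      · have : sPart (coords y (0 : γ → ℂ) s) = s := by funext e'; simp [sPart]
        rw [this]; exact hs
    have hxu : x + coords y (0 : γ → ℂ) s ∈ H := AnalyticGroupModel.add_mem_of_mem_linSpace hx hu
    have h := ha _ hxu
    rw [← h, Finset.sum_comm]
    refine Finset.sum_congr rfl fun μ' hμ' => ?_
    rw [hE, Finset.sum_mul, Finset.sum_mul]
    refine Finset.sum_congr rfl fun k _ => ?_
    have hq : thetaEval L cls κM (Q k) (x + coords y (0 : γ → ℂ) s) = thetaEval L cls κM (Q k) x :=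
      thetaEval_pureRename_eq_of_zPart_eq L cls κM (P k) (by funext b; simp [zPart])
    rw [hq, thetaEval_fibForm_add L cls κM M₀ Fy Fs (hT μ' hμ') hx0 y s]
    ring
  -- Step B: the pure coefficient forms vanish on `H`
  have hQhom : ∀ μ, (∑ k, a k μ • Q k).IsHomogeneous d := fun μ =>
    (homogeneousSubmodule _ ℂ d).sum_mem fun k _ => (homogeneousSubmodule _ ℂ d).smul_mem _ (hPhom k)
  have hQeval : ∀ μ w, thetaEval L cls κM (∑ k, a k μ • Q k) w = ∑ k, a k μ * thetaEval L cls κM (Q k) w := by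
    intro μ w
    simp only [thetaEval, map_sum, smul_eval]
  have hJ₀ : ∀ w, theta L cls κM (fibJ₀ (β := β) (δ := δ) M₀) w = thetaPnone (β := β) (δ := δ) L cls M₀ w := fun w => by
    simp [fibJ₀, theta]
  have hB : ∀ μ ∈ T, ∀ x ∈ H, ∑ k, a k μ * thetaEval L cls κM (Q k) x = 0 := by
    intro μ hμ x hx
    rw [← hQeval]
    refine thetaEval_eq_zero_of_mul_X L cls κM M e hΘ hH (hQhom μ) (fibJ₀ (β := β) (δ := δ) M₀) (by rwa [hJ₀]) ?_ x hx
    intro x' hx' hx'0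
    rw [hQeval]
    exact hA x' hx' (by rwa [hJ₀] at hx'0) μ hμ
  -- Step C: Kronecker
  have hQsum : ∀ μ, ∑ k, a k μ • Q k = rename (pureIdx (β := β) (δ := δ)) (∑ k, a k μ • P k) := by
    intro μ; simp only [hQ, map_sum, map_smul]
  have hC : ∀ μ ∈ T, ∀ z ∈ KronFam.ratHullCls cls 𝔷₀,
      thetaEval L cls κM (∑ k, a k μ • Q k) (coords (0 : β → ℂ) z (0 : δ → ℂ)) = 0 := by
    intro μ hμ
    refine KronFam.eq_zero_on_ratHullCls L cls hiso hcm1 (differentiable_thetaEval_coords L cls κM _) ?_ 𝔷₀ ?_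
    · intro z hz m' n'
      rw [hQsum] at hz ⊢
      exact thetaEval_pureRename_coords_add_latt L cls κM (by rw [← hQsum]; exact hQhom μ) z hz m' n'
    · intro z hz
      obtain ⟨w, hw, rfl⟩ := Submodule.mem_map.mp hz
      have hwH : (w : β ⊕ (γ ⊕ δ) → ℂ) ∈ H := AnalyticGroupModel.linSpace_subset H hw
      have : thetaEval L cls κM (∑ k, a k μ • Q k) (coords (0 : β → ℂ) (zProj w) (0 : δ → ℂ)) =
          thetaEval L cls κM (∑ k, a k μ • Q k) w := by
        rw [hQsum]
        exact (thetaEval_pureRename_zEmb L cls κM _ w).symm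
      rw [this, hQeval]
      exact hB μ hμ w hwH
  -- Step D: independence of the pure forms on `ratHull 𝔷₀`
  intro k μ hμ
  have := Fintype.linearIndependent_iff.mp hPli (fun k' => a k' μ) ?_ k
  · exact this
  funext z
  simp only [Finset.sum_apply, Pi.smul_apply, smul_eq_mul, Pi.zero_apply]
  have hz : (z : γ → ℂ) ∈ KronFam.ratHullCls cls 𝔷₀ := by
    rw [← TZ_pureData_zRelCls cls]
    exact z.2
  have := hC μ hμ z hz
  rwa [hQeval] at this

/-! ### The count -/

omit [DecidableEq 𝓙] in
/-- **`dim ratHull 𝔷₀ + dim yDir + dim sDir + 1 ≤ coneDim H`** for a closed irreducible subgroup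
`H` (no CM): the products of pure and fibre forms in all degrees `≤ t` give
`H(𝔍(H); 2t) ≥ binom(t + D + 1, D + 1)`, `D = dim ratHull 𝔷₀ + dim yDir + dim sDir`, against the
Hilbert sandwich of the prime `𝔍(H)`. [folklore] -/
theorem finrank_ratHullCls_add_le_coneDim (hiso : ∀ i j, i ≠ j → ¬ (L i).IsIsogenousTo (L j))
    (hcm1 : ∀ b b', cls b = cls b' → (L (cls b)).HasCM → b = b') {H : AddSubgroup (β ⊕ (γ ⊕ δ) → ℂ)}
    (hH : M.IsIrred (H : Set (β ⊕ (γ ⊕ δ) → ℂ))) :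
    finrank ℂ (KronFam.ratHullCls cls ((AnalyticGroupModel.linSpace (H : Set (β ⊕ (γ ⊕ δ) → ℂ))).map zProj)) +
      (finrank ℂ (yDir (AnalyticGroupModel.linSpace (H : Set (β ⊕ (γ ⊕ δ) → ℂ)))) +
        finrank ℂ (sDir (AnalyticGroupModel.linSpace (H : Set (β ⊕ (γ ⊕ δ) → ℂ))))) + 1 ≤
      M.coneDim (H : Set (β ⊕ (γ ⊕ δ) → ℂ)) := by
  classical
  set 𝔥 := AnalyticGroupModel.linSpace (H : Set (β ⊕ (γ ⊕ δ) → ℂ)) with h𝔥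
  set 𝔷₀ := 𝔥.map zProj with h𝔷₀
  -- the data of the two families
  obtain ⟨Fy, hFy, hby⟩ := (yDir 𝔥).exists_finset_restrict_bijective
  obtain ⟨Fs, hFs, hbs⟩ := (sDir 𝔥).exists_finset_restrict_bijective
  obtain ⟨M₀, hM₀⟩ := exists_thetaPnone_ne_zero (β := β) (δ := δ) L cls (0 : β ⊕ (γ ⊕ δ) → ℂ)
  set d₁ := finrank ℂ (pureData (zRelCls cls 𝔷₀)).TZ with hd₁
  have hd₁' : finrank ℂ (KronFam.ratHullCls cls 𝔷₀) = d₁ := by rw [hd₁, TZ_pureData_zRelCls]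
  set D := d₁ + (Fy.card + Fs.card) with hD
  rw [hd₁', ← hFy, ← hFs]
  suffices hmain : D + 1 ≤ M.coneDim (H : Set (β ⊕ (γ ⊕ δ) → ℂ)) by omega
  -- the sandwich of `𝔍(H)`
  haveI := hH.isPrime
  set cd := M.coneDim (H : Set (β ⊕ (γ ⊕ δ) → ℂ)) with hcd
  have hdim : ringKrullDim (MvPolynomial (Fin (N + 1)) ℂ ⧸ M.vanishing (H : Set (β ⊕ (γ ⊕ δ) → ℂ))) = cd :=
    (M.coneDim_eq ⟨0, H.zero_mem⟩).symm
  obtain ⟨ρ, a', γ', -, hs⟩ := ZeroEst.exists_sandwich_of_isPrime (𝔭 := M.vanishing (H : Set (β ⊕ (γ ⊕ δ) → ℂ))) hdim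
  refine AnalyticGroupModel.exponent_le_of_choose_le (d₁ := D + 1) (ρ₁ := 1) (a₁ := 0) (K := 1) (ρ₂ := ρ) (c := 2)
    (γ₂ := γ') (t₀ := a') le_rfl fun t ht => ?_
  rw [one_mul, one_mul, Nat.sub_zero]
  -- the families in each degree `d ≤ t`
  have hfam := fun dd : Fin (t + 1) => exists_linearIndependent_pure (β := β) (δ := δ) L cls κM (zRelCls cls 𝔷₀) (dd : ℕ)
  choose n P hn hhom hli using hfam
  -- the index type and the forms
  let Ix : Type := Σ dd : Fin (t + 1), Fin (n dd) × ↥(degLE (fibIdx Fy Fs) (dd : ℕ))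
  let form : Ix → MvPolynomial (Option β × ThetaIdx γ δ) ℂ := fun i =>
    rename (pureIdx (β := β) (δ := δ)) (P i.1 i.2.1) * fibForm M₀ Fy Fs (i.1 : ℕ) (i.2.2 : fibIdx Fy Fs →₀ ℕ)
  have hdegμ : ∀ i : Ix, (i.2.2 : fibIdx Fy Fs →₀ ℕ).degree ≤ (i.1 : ℕ) := fun i => mem_degLE_iff.mp i.2.2.2
  have hformhom : ∀ i : Ix, (form i).IsHomogeneous ((i.1 : ℕ) + (i.1 : ℕ)) := fun i =>
    (hhom i.1 i.2.1).mul (isHomogeneous_fibForm M₀ Fy Fs (hdegμ i))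
  -- the evaluation map on the cone over `H`
  let Ψ : ZeroEst.Fil (N := N) (2 * t) →ₗ[ℂ] (ℂ × H → ℂ) :=
    { toFun := fun Q p => eval (p.1 • M.pt (p.2 : β ⊕ (γ ⊕ δ) → ℂ)) (Q : MvPolynomial (Fin (N + 1)) ℂ)
      map_add' := fun Q Q' => by funext p; simp
      map_smul' := fun c Q => by funext p; simp [smul_eval] }
  have hΨapply : ∀ (Q : ZeroEst.Fil (N := N) (2 * t)) (p : ℂ × H),
      Ψ Q p = eval (p.1 • M.pt (p.2 : β ⊕ (γ ⊕ δ) → ℂ)) (Q : MvPolynomial (Fin (N + 1)) ℂ) := fun _ _ => rfl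
  have hker : LinearMap.ker Ψ =
      ((M.vanishing (H : Set (β ⊕ (γ ⊕ δ) → ℂ))).restrictScalars ℂ).comap (ZeroEst.Fil (N := N) (2 * t)).subtype := by
    ext Q
    simp only [LinearMap.mem_ker, Submodule.mem_comap, Submodule.coe_subtype, Submodule.restrictScalars_mem]
    rw [M.mem_vanishing_iff]
    constructor
    · intro h w hw c
      have := congr_fun h (c, ⟨w, hw⟩)
      rwa [hΨapply] at this
    · intro h
      funext p
      rw [hΨapply]
      exact h _ p.2.2 p.1
  have hkerdim : finrank ℂ (LinearMap.ker Ψ) =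
      finrank ℂ ↥(ZeroEst.Fil (N := N) (2 * t) ⊓ (M.vanishing (H : Set (β ⊕ (γ ⊕ δ) → ℂ))).restrictScalars ℂ) := by
    rw [hker]
    have e1 : Submodule.comap (ZeroEst.Fil (N := N) (2 * t)).subtype
        ((M.vanishing (H : Set (β ⊕ (γ ⊕ δ) → ℂ))).restrictScalars ℂ) =
        Submodule.comap (ZeroEst.Fil (N := N) (2 * t)).subtype
          (ZeroEst.Fil (2 * t) ⊓ (M.vanishing (H : Set (β ⊕ (γ ⊕ δ) → ℂ))).restrictScalars ℂ) := by
      rw [Submodule.comap_inf, Submodule.comap_subtype_self, top_inf_eq]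
    rw [e1]
    exact (Submodule.comapSubtypeEquivOfLe inf_le_left).finrank_eq
  have hHilb : ZeroEst.hilbC ((M.vanishing (H : Set (β ⊕ (γ ⊕ δ) → ℂ))).restrictScalars ℂ) (2 * t) =
      finrank ℂ (LinearMap.range Ψ) := by
    have h1 := ZeroEst.hilbC_add_finrank_inf (N := N) ((M.vanishing (H : Set (β ⊕ (γ ⊕ δ) → ℂ))).restrictScalars ℂ) (2 * t)
    have h2 := LinearMap.finrank_range_add_finrank_ker Ψ
    omega
  -- the combined family in `Fil (2t)`
  have hmemFil : ∀ i : Ix, rename e (form i) ∈ ZeroEst.Fil (N := N) (2 * t) := fun i =>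
    ZeroEst.mem_Fil.mpr (((hformhom i).rename_isHomogeneous.totalDegree_le).trans (by have := i.1.2; omega))
  let f : Ix → ZeroEst.Fil (N := N) (2 * t) := fun i => ⟨rename e (form i), hmemFil i⟩
  have hΨf : ∀ (i : Ix) (p : ℂ × H),
      Ψ (f i) p = p.1 ^ ((i.1 : ℕ) + (i.1 : ℕ)) * thetaEval L cls κM (form i) (p.2 : β ⊕ (γ ⊕ δ) → ℂ) := by
    intro i p
    rw [hΨapply]
    show eval (p.1 • M.pt (p.2 : β ⊕ (γ ⊕ δ) → ℂ)) (rename e (form i)) = _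
    rw [M.eval_smul_pt (hformhom i).rename_isHomogeneous, F_rename L cls κM M e hΘ]
  have hliΨ : LinearIndependent ℂ fun i : Ix => Ψ (f i) := by
    rw [Fintype.linearIndependent_iff]
    intro α hα
    have hcw : ∀ (w : H) (c : ℂ), ∑ dd : Fin (t + 1), c ^ ((dd : ℕ) + (dd : ℕ)) *
        ∑ q : Fin (n dd) × ↥(degLE (fibIdx Fy Fs) (dd : ℕ)), α ⟨dd, q⟩ * thetaEval L cls κM (form ⟨dd, q⟩) (w : β ⊕ (γ ⊕ δ) → ℂ) = 0 := by
      intro w c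
      have := congr_fun hα (c, w)
      simp only [Finset.sum_apply, Pi.smul_apply, smul_eq_mul, Pi.zero_apply] at this
      rw [← this, ← Finset.univ_sigma_univ, Finset.sum_sigma]
      refine Finset.sum_congr rfl fun dd _ => ?_
      rw [Finset.mul_sum]
      refine Finset.sum_congr rfl fun q _ => ?_
      rw [hΨf]; ring
    have hcoef : ∀ (w : H) (dd : Fin (t + 1)),
        ∑ q : Fin (n dd) × ↥(degLE (fibIdx Fy Fs) (dd : ℕ)), α ⟨dd, q⟩ * thetaEval L cls κM (form ⟨dd, q⟩) (w : β ⊕ (γ ⊕ δ) → ℂ) = 0 := by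
      intro w dd
      set q : Polynomial ℂ := ∑ dd : Fin (t + 1), Polynomial.monomial ((dd : ℕ) + (dd : ℕ))
        (∑ q : Fin (n dd) × ↥(degLE (fibIdx Fy Fs) (dd : ℕ)), α ⟨dd, q⟩ * thetaEval L cls κM (form ⟨dd, q⟩) (w : β ⊕ (γ ⊕ δ) → ℂ)) with hq
      have hqeval : ∀ c : ℂ, q.eval c = 0 := by
        intro c
        rw [hq, Polynomial.eval_finsetSum, ← hcw w c]
        refine Finset.sum_congr rfl fun dd _ => ?_
        rw [Polynomial.eval_monomial]; ring
      have hq0 : q = 0 := Polynomial.funext fun c => by rw [hqeval c, Polynomial.eval_zero]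
      have hc : q.coeff ((dd : ℕ) + (dd : ℕ)) = 0 := by rw [hq0, Polynomial.coeff_zero]
      rw [hq, Polynomial.finsetSum_coeff, Finset.sum_eq_single dd] at hc
      · simpa [Polynomial.coeff_monomial] using hc
      · intro d' _ hd'
        rw [Polynomial.coeff_monomial, if_neg]
        intro h
        exact hd' (Fin.ext (by omega))
      · intro h; exact absurd (Finset.mem_univ dd) h
    -- per degree: the products are independent
    rintro ⟨dd, k, μ⟩
    have hind := thetaEval_products_independent L cls κM M e hΘ hiso hcm1 hH (dd : ℕ) (P dd) (hhom dd) (hli dd) M₀ hM₀ Fy Fs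
      hby.2 hbs.2 (degLE (fibIdx Fy Fs) (dd : ℕ)) (fun μ hμ => mem_degLE_iff.mp hμ)
      (fun k' μ' => if h : μ' ∈ degLE (fibIdx Fy Fs) (dd : ℕ) then α ⟨dd, k', ⟨μ', h⟩⟩ else 0) ?_ k μ μ.2
    · simpa using hind
    intro w hw
    rw [← hcoef ⟨w, hw⟩ dd, ← Finset.univ_product_univ, Finset.sum_product]
    refine Finset.sum_congr rfl fun k' _ => ?_
    rw [← Finset.sum_coe_sort (degLE (fibIdx Fy Fs) (dd : ℕ))]
    refine Finset.sum_congr rfl fun μ' _ => ?_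
    rw [dif_pos μ'.2]
    simp only [form, thetaEval, map_mul]
  have hli' : LinearIndependent ℂ fun i : Ix => (⟨Ψ (f i), LinearMap.mem_range_self Ψ (f i)⟩ : LinearMap.range Ψ) :=
    LinearIndependent.of_comp (LinearMap.range Ψ).subtype hliΨ
  have hcard := hli'.fintype_card_le_finrank
  rw [Fintype.card_sigma] at hcard
  simp only [Fintype.card_prod, Fintype.card_fin, Fintype.card_coe] at hcard
  -- counting
  have hcount : ∀ dd : Fin (t + 1), ((dd : ℕ) + D).choose D ≤ n dd * (degLE (fibIdx Fy Fs) (dd : ℕ)).card := by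
    intro dd
    rw [hn dd, card_degLE, hD]
    have h := choose_add_le_choose_mul_choose (ι₁ := Fin d₁) (ι₂ := fibIdx Fy Fs) (dd : ℕ)
    simp only [Fintype.card_fin] at h
    have hc : Fintype.card (fibIdx Fy Fs) = Fy.card + Fs.card := by
      rw [Fintype.card_sum, Fintype.card_coe, Fintype.card_coe]
    rw [hc] at h ⊢
    exact h
  have hsum : (t + D + 1).choose (D + 1) ≤ ∑ dd : Fin (t + 1), n dd * (degLE (fibIdx Fy Fs) (dd : ℕ)).card := by
    rw [← sum_fin_add_choose t D]
    exact Finset.sum_le_sum fun dd _ => hcount dd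
  calc (t + (D + 1)).choose (D + 1) = (t + D + 1).choose (D + 1) := by rw [← add_assoc]
    _ ≤ ∑ dd : Fin (t + 1), n dd * (degLE (fibIdx Fy Fs) (dd : ℕ)).card := hsum
    _ ≤ finrank ℂ (LinearMap.range Ψ) := hcard
    _ = ZeroEst.hilbC ((M.vanishing (H : Set (β ⊕ (γ ⊕ δ) → ℂ))).restrictScalars ℂ) (2 * t) := hHilb.symm
    _ ≤ ρ * (2 * t + γ' + cd).choose cd := (hs (2 * t) (by omega)).2

/-! ### Saturation of the abelian projection -/

omit [DecidableEq 𝓙] in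
/-- **`dim 𝒯(H) ≤ dim 𝔷₀ + dim yDir + dim sDir`** (rank–nullity for `z'|_{𝒯(H)}` and the product
structure of its kernel). [folklore] -/
theorem finrank_linSpace_le {H : AddSubgroup (β ⊕ (γ ⊕ δ) → ℂ)} (hH : M.IsClosedG (H : Set (β ⊕ (γ ⊕ δ) → ℂ))) :
    finrank ℂ (AnalyticGroupModel.linSpace (H : Set (β ⊕ (γ ⊕ δ) → ℂ))) ≤
      finrank ℂ ((AnalyticGroupModel.linSpace (H : Set (β ⊕ (γ ⊕ δ) → ℂ))).map zProj) +
        (finrank ℂ (yDir (AnalyticGroupModel.linSpace (H : Set (β ⊕ (γ ⊕ δ) → ℂ)))) +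
          finrank ℂ (sDir (AnalyticGroupModel.linSpace (H : Set (β ⊕ (γ ⊕ δ) → ℂ))))) := by
  set 𝔥 := AnalyticGroupModel.linSpace (H : Set (β ⊕ (γ ⊕ δ) → ℂ)) with h𝔥
  set f : 𝔥 →ₗ[ℂ] (γ → ℂ) := (zProj (β := β) (δ := δ)).domRestrict 𝔥 with hf
  have hrange : LinearMap.range f = 𝔥.map zProj := by
    ext z
    simp only [LinearMap.mem_range, Submodule.mem_map, hf, LinearMap.domRestrict_apply]
    constructor
    · rintro ⟨u, rfl⟩; exact ⟨u, u.2, rfl⟩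
    · rintro ⟨u, hu, rfl⟩; exact ⟨⟨u, hu⟩, rfl⟩
  have hrn := LinearMap.finrank_range_add_finrank_ker f
  rw [hrange] at hrn
  -- the kernel embeds into `yDir × sDir`
  have hkmem : ∀ u : LinearMap.ker f, yPart ((u : 𝔥) : β ⊕ (γ ⊕ δ) → ℂ) ∈ yDir 𝔥 ∧ sPart ((u : 𝔥) : β ⊕ (γ ⊕ δ) → ℂ) ∈ sDir 𝔥 := by
    intro u
    have hz : ∀ b, ((u : 𝔥) : β ⊕ (γ ⊕ δ) → ℂ) (iz b) = 0 := fun b => by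
      have := u.2
      rw [LinearMap.mem_ker] at this
      exact congr_fun this b
    exact (mem_linSpace_iff_of_z_eq_zero L cls κM M e hΘ hH hz).mp (u : 𝔥).2
  let g : LinearMap.ker f →ₗ[ℂ] (yDir 𝔥 × sDir 𝔥) :=
    { toFun := fun u => (⟨yPart ((u : 𝔥) : β ⊕ (γ ⊕ δ) → ℂ), (hkmem u).1⟩, ⟨sPart ((u : 𝔥) : β ⊕ (γ ⊕ δ) → ℂ), (hkmem u).2⟩)
      map_add' := fun u v => by ext <;> rfl
      map_smul' := fun c u => by ext <;> rfl }
  have hg : Function.Injective g := by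
    intro u v huv
    have hy : yPart ((u : 𝔥) : β ⊕ (γ ⊕ δ) → ℂ) = yPart ((v : 𝔥) : β ⊕ (γ ⊕ δ) → ℂ) :=
      congr_arg (fun p : yDir 𝔥 × sDir 𝔥 => (p.1 : β → ℂ)) huv
    have hs : sPart ((u : 𝔥) : β ⊕ (γ ⊕ δ) → ℂ) = sPart ((v : 𝔥) : β ⊕ (γ ⊕ δ) → ℂ) :=
      congr_arg (fun p : yDir 𝔥 × sDir 𝔥 => (p.2 : δ → ℂ)) huv
    have hzu : ∀ b, ((u : 𝔥) : β ⊕ (γ ⊕ δ) → ℂ) (iz b) = 0 := fun b => by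
      have := u.2
      rw [LinearMap.mem_ker] at this
      exact congr_fun this b
    have hzv : ∀ b, ((v : 𝔥) : β ⊕ (γ ⊕ δ) → ℂ) (iz b) = 0 := fun b => by
      have := v.2
      rw [LinearMap.mem_ker] at this
      exact congr_fun this b
    apply Subtype.ext; apply Subtype.ext
    rw [eq_coords_add_of_z_eq_zero hzu, eq_coords_add_of_z_eq_zero hzv, hy, hs]
  have hker := LinearMap.finrank_le_finrank_of_injective hg
  rw [Module.finrank_prod] at hker
  omega

omit [DecidableEq 𝓙] in
/-- **Saturation of the abelian projection of the lineality space** of a closed irreducible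
subgroup (no complex multiplication): `ratHull z'(𝒯(H)) = z'(𝒯(H))`, i.e. `z'(𝒯(H))` is cut out
by rational linear equations. [folklore] -/
theorem ratHullCls_zProj_linSpace_eq (hiso : ∀ i j, i ≠ j → ¬ (L i).IsIsogenousTo (L j))
    (hcm1 : ∀ b b', cls b = cls b' → (L (cls b)).HasCM → b = b') {H : AddSubgroup (β ⊕ (γ ⊕ δ) → ℂ)}
    (hH : M.IsIrred (H : Set (β ⊕ (γ ⊕ δ) → ℂ))) :
    KronFam.ratHullCls cls ((AnalyticGroupModel.linSpace (H : Set (β ⊕ (γ ⊕ δ) → ℂ))).map zProj) =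
      (AnalyticGroupModel.linSpace (H : Set (β ⊕ (γ ⊕ δ) → ℂ))).map zProj := by
  have h1 := finrank_ratHullCls_add_le_coneDim L cls κM M e hΘ hiso hcm1 hH
  have h2 := M.coneDim_le_finrank_linSpace_succ H hH
  have h3 := finrank_linSpace_le L cls κM M e hΘ hH.isClosedG
  refine (Submodule.eq_of_le_of_finrank_le (KronFam.le_ratHullCls cls _) ?_).symm
  omega

end Model

end Std

end GaGmEFam

end Literature.NumberTheory.Transcendental

end
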